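import Summits.ResolutionOfSingularities.ResolutionOfSingularities.Theorems.FrobeniusClosingSteerCriticalSurface
import Summits.ResolutionOfSingularities.ResolutionOfSingularities.Theorems.FrobeniusClosingSteerJacobianThinness
import Mathlib.Algebra.CharP.Lemmas
import HarnessLib

/-!
# Crux `Steer` (stmt-ResolutionOfSingularities-16345), chain W4.1, p = 2 σ-residual, LOW half: THE CRITICAL SURFACE IS FOLLOWED
# (res-L0-w41-idea-3 card 3 v2, C5 `CriticalSurfaceFollowed` = res-L0-w41-strat-2's B8₁/B9), from the Jacobian-pair transform law
# `e ↦ e/x` (idea-3's C9) — Theses-free, def-free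

OURS (campaign `res-hironaka`, rung L ★L-G4, slot W4.1; holder of record res-L0-w41-lead-1 g4; replaces the role of no printed item; NOT a
statement of the manuscript under review [claim: Hironaka2017, status: under-review]; AI review is weaker than expert review). Sibling of
`FrobeniusClosingSteerCriticalSurface.lean` (C1–C3) and `FrobeniusClosingSteerCriticalSurfaceDictionary.lean` (C7).

THE LEVER (idea-3 card 3 v2 (a)+(b)), made kernel-exact and COORDINATE-FREE: let `R ≤ R' ⊆ K` be one step of the run (`R'` dominates `R`,
`𝔪_R / x ⊆ R'` for the exceptional parameter `x`), `s = x·s' + G` the strict step, `f = s²` in low shape `f − g² = l₁ l₂ + c` (`c ∈ 𝔪³`)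
with dual derivations `D₁, D₂` of `R`, and suppose the twisted derivations `x·D₁, x·D₂` extend to derivations `D₁', D₂'` OF `R'`
(idea-3's C9 `jacobianPair_transform`: `(x·D)(y/x) = D y − (y/x)·D x`, so `x·D` preserves `R[𝔪/x]` and its localisations — taken here
as the hypothesis «`D_j' y = x · D_j y` on `R`» in `_of_transform`, and DISCHARGED along a quadratic transform along `O` by the tree's
`SteerRankThinness.exists_derivation_smul_quadraticTransformAlong` in `criticalSurfaceFollowed`). Then in
characteristic `2`: `x² · s'² = s² − G²` gives `x² · D_j'(s'²) = x · D_j(s²) = x · e_j`, i.e. **`D_j'(f') = e_j / x`** (the transform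
law); if the next stage is SINGULAR at its closed point (`f' − γ² ∈ 𝔪'²` for some `γ`), then `D_j'(f') = D_j'(f' − γ²) ∈ 𝔪'` (derivations
kill squares and map `𝔪'²` into `𝔪'` — C1's mechanism), so `e_j / x ∈ 𝔪'`; and `e₁ = l₂ + D₁ c`, `e₂ = l₁ + D₂ c` with `D c ∈ 𝔪²`,
`𝔪²/x ⊆ 𝔪'`, whence **`l₁/x, l₂/x ∈ 𝔪'`**: the new centre lies on the strict transform of the critical surface Σ₂ = V(e₁, e₂) — the
direction of a non-exiting step is in the polar radical. No residue-field rationality, no perfectness, no coordinates (the «C-κ caveat»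
of tri-2/idea-3 does not arise). If `l₁/x` happens to be a unit of `R'` (e.g. `x = l₁`), the conclusion says the next stage CANNOT be
singular: the run exits.

* `CriticalSurface.derivation_transform_apply_sq` — the transform law `(D'(s'²) : K) = D(s²) / x`.
* `CriticalSurface.div_mem_maximalIdeal_of_mem_sq` — `𝔪_R² / x ⊆ 𝔪_{R'}`.
* `CriticalSurface.criticalSurfaceFollowed_of_transform` — C5 for any step `R ≤ R'` carrying the two compatible derivations of `R'`.
* **`CriticalSurface.criticalSurfaceFollowed`** — C5 UNCONDITIONAL along a quadratic transform along `O` (the derivations from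
  res-L0-w41-idea-1's `SteerRankThinness.exists_derivation_smul_quadraticTransformAlong`, `…SteerJacobianThinness`).

[cite: Matsumura1987, Thm. 25.1, Thm. 30.6] [folklore]
-/

noncomputable section

-- `Summit.<S>.<S>.…` duplicates the summit name by design (single-problem summit).
set_option linter.dupNamespace false

open Polynomial IsLocalRing

namespace Summit.ResolutionOfSingularities.ResolutionOfSingularities.Theorems.SwitchingDichotomy

open Literature.AlgebraicGeometry.Resolution

namespace CriticalSurface

variable {K : Type} [Field K]

/-- `𝔪_R² / x ⊆ 𝔪_{R'}` along a step `R ≤ R'` with `𝔪_R ⊆ 𝔪_{R'}` (domination) and `𝔪_R / x ⊆ R'` (the chart of the exceptional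
parameter `x`): for `y ∈ 𝔪_R²`, `y / x` lies in (the image in `K` of) `𝔪_{R'}`. [folklore] -/
theorem div_mem_maximalIdeal_of_mem_sq (R R' : Subring K) [IsLocalRing R] [IsLocalRing R'] (hle : R ≤ R')
    (hdom : ∀ y : R, y ∈ maximalIdeal R → (⟨(y : K), hle y.2⟩ : R') ∈ maximalIdeal R')
    (x : K) (hdiv : ∀ y : R, y ∈ maximalIdeal R → (y : K) / x ∈ R')
    {y : R} (hy : y ∈ maximalIdeal R ^ 2) :
    ∃ h : (y : K) / x ∈ R', (⟨(y : K) / x, h⟩ : R') ∈ maximalIdeal R' := by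
  -- the image of `𝔪'` in `K` is closed under the operations met in the induction
  let M : Set K := {z | ∃ h : z ∈ R', (⟨z, h⟩ : R') ∈ maximalIdeal R'}
  suffices hM : (y : K) / x ∈ M from hM
  rw [pow_two] at hy
  refine Submodule.mul_induction_on hy (fun a ha b hb => ?_) (fun a b ha hb => ?_)
  · -- `(a b)/x = (a/x) · b` with `a/x ∈ R'` and `b ∈ 𝔪'`
    refine ⟨?_, ?_⟩
    · have : ((a * b : R) : K) / x = (a : K) / x * (b : K) := by push_cast; ring
      rw [this]; exact R'.mul_mem (hdiv a ha) (hle b.2)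
    · have hb' := hdom b hb
      have heq : (⟨((a * b : R) : K) / x, by
          have : ((a * b : R) : K) / x = (a : K) / x * (b : K) := by push_cast; ring
          rw [this]; exact R'.mul_mem (hdiv a ha) (hle b.2)⟩ : R') =
          ⟨(a : K) / x, hdiv a ha⟩ * ⟨(b : K), hle b.2⟩ := Subtype.ext (by push_cast; ring)
      rw [heq]
      exact Ideal.mul_mem_left _ _ hb'
  · obtain ⟨ha1, ha2⟩ := ha
    obtain ⟨hb1, hb2⟩ := hb
    refine ⟨?_, ?_⟩
    · have : ((a + b : R) : K) / x = (a : K) / x + (b : K) / x := by push_cast; ring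
      rw [this]; exact R'.add_mem ha1 hb1
    · have heq : (⟨((a + b : R) : K) / x, by
          have : ((a + b : R) : K) / x = (a : K) / x + (b : K) / x := by push_cast; ring
          rw [this]; exact R'.add_mem ha1 hb1⟩ : R') = ⟨(a : K) / x, ha1⟩ + ⟨(b : K) / x, hb1⟩ :=
        Subtype.ext (by push_cast; ring)
      rw [heq]
      exact Ideal.add_mem _ ha2 hb2

/-- **The transform law `D'(f') = D(f)/x`** (idea-3's C9 at the level of one radicand): in characteristic `2`, if `s = x·s' + G` with
`s², G ∈ R`, `s'² ∈ R'`, `R ≤ R'`, `x ∈ R` non-zero, and `D'` is a derivation of `R'` extending `x·D` (`D' y = x · D y` for `y ∈ R`),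
then `D'(s'²) = D(s²) / x` in `K`. (From `x²·s'² = s² − G²`, derivations killing squares.) [folklore] -/
theorem derivation_transform_apply_sq [CharP K 2] (R R' : Subring K) (hle : R ≤ R') (x : K) (hxR : x ∈ R) (hx0 : x ≠ 0)
    (s s' G : K) (hs : s ^ 2 ∈ R) (hs' : s' ^ 2 ∈ R') (hG : G ∈ R) (hstep : s = x * s' + G)
    (D : Derivation ℤ R R) (D' : Derivation ℤ R' R')
    (hD' : ∀ y : R, ((D' ⟨(y : K), hle y.2⟩ : R') : K) = x * ((D y : R) : K)) :
    ((D' ⟨s' ^ 2, hs'⟩ : R') : K) = ((D ⟨s ^ 2, hs⟩ : R) : K) / x := by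
  haveI : Fact (2 : ℕ).Prime := ⟨Nat.prime_two⟩
  haveI : CharP R' 2 := inferInstance
  -- the identity `x² · s'² = s² − G²` inside `R'`
  set X' : R' := ⟨x, hle hxR⟩ with hX'
  set F' : R' := ⟨s' ^ 2, hs'⟩ with hF'
  set fR : R' := ⟨s ^ 2, hle hs⟩ with hfR
  set GR : R' := ⟨G, hle hG⟩ with hGR
  have hK : x ^ 2 * s' ^ 2 = s ^ 2 - G ^ 2 := by
    have h1 : x * s' = s - G := by rw [hstep]; ring
    rw [← mul_pow, h1, sub_pow_char s G]
  have hid : X' ^ 2 * F' = fR - GR ^ 2 := Subtype.ext (by push_cast; exact hK)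
  -- apply `D'`
  have h2 := congrArg D' hid
  rw [D'.leibniz, derivation_apply_sq, smul_zero, add_zero, map_sub, derivation_apply_sq, sub_zero, smul_eq_mul] at h2
  -- `h2 : X' ^ 2 * D' F' = D' fR`
  have h3 : x ^ 2 * ((D' F' : R') : K) = x * ((D ⟨s ^ 2, hs⟩ : R) : K) := by
    have := congrArg (fun z : R' => (z : K)) h2
    simp only [Subring.coe_mul, Subring.coe_pow] at this
    rw [this]
    exact hD' ⟨s ^ 2, hs⟩
  rw [eq_div_iff hx0]
  have h4 : x * (((D' F' : R') : K) * x) = x * ((D ⟨s ^ 2, hs⟩ : R) : K) := by rw [← h3]; ring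
  exact mul_left_cancel₀ hx0 h4

/-- **(C5) The critical surface is followed** (res-L0-w41-idea-3's `CriticalSurfaceFollowed` = res-L0-w41-strat-2's B8₁/B9, COORDINATE-FREE,
modulo the C9 hypothesis that the twisted dual derivations `x·D₁, x·D₂` extend to derivations `D₁', D₂'` of the next member): in low shape
`s² − g² = l₁ l₂ + c` (`c ∈ 𝔪³`, `(l₁, l₂, l₃, l₄) = 𝔪`, `D₁, D₂` dual to `l₁, l₂`), after a step `R ≤ R'` (`R'` dominating `R`,
`𝔪/x ⊆ R'`, strict step `s = x·s' + G`), if the next stage is SINGULAR at its closed point (`s'² − γ² ∈ 𝔪'²` for some `γ ∈ R'`), then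
`l₁/x, l₂/x ∈ 𝔪_{R'}`: the new centre lies on the strict transform of the critical surface Σ₂ (direction in the polar radical). Proof:
`D_j'(s'²) = e_j/x` (`derivation_transform_apply_sq`) lies in `𝔪'` because `D_j'` kills `γ²` and maps `𝔪'²` into `𝔪'`; `e₁ = l₂ + D₁ c`,
`e₂ = l₁ + D₂ c`, and `D c / x ∈ 𝔪'` (`c ∈ 𝔪³ ⇒ D c ∈ 𝔪²`, `div_mem_maximalIdeal_of_mem_sq`). OURS. [cite: Matsumura1987, Thm. 30.6]
[folklore] -/
theorem criticalSurfaceFollowed_of_transform [CharP K 2] (R R' : Subring K) [IsRegularLocalRing R] [IsRegularLocalRing R']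
    (hle : R ≤ R') (hdom : ∀ y : R, y ∈ maximalIdeal R → (⟨(y : K), hle y.2⟩ : R') ∈ maximalIdeal R')
    (x : K) (hxR : x ∈ R) (hx0 : x ≠ 0) (hdiv : ∀ y : R, y ∈ maximalIdeal R → (y : K) / x ∈ R')
    (s s' G : K) (hs : s ^ 2 ∈ R) (hs' : s' ^ 2 ∈ R') (hG : G ∈ R) (hstep : s = x * s' + G)
    (g l₁ l₂ l₃ l₄ c : R) (hf : (⟨s ^ 2, hs⟩ : R) - g ^ 2 = l₁ * l₂ + c) (hc : c ∈ maximalIdeal R ^ 3)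
    (hspan : Ideal.span {l₁, l₂, l₃, l₄} = maximalIdeal R)
    (D₁ D₂ : Derivation ℤ R R) (h11 : D₁ l₁ = 1) (h12 : D₁ l₂ = 0) (h21 : D₂ l₁ = 0) (h22 : D₂ l₂ = 1)
    (D₁' D₂' : Derivation ℤ R' R')
    (hD₁' : ∀ y : R, ((D₁' ⟨(y : K), hle y.2⟩ : R') : K) = x * ((D₁ y : R) : K))
    (hD₂' : ∀ y : R, ((D₂' ⟨(y : K), hle y.2⟩ : R') : K) = x * ((D₂ y : R) : K))
    (hsing : ∃ γ : R', (⟨s' ^ 2, hs'⟩ : R') - γ ^ 2 ∈ maximalIdeal R' ^ 2) :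
    ∃ (h₁ : (l₁ : K) / x ∈ R') (h₂ : (l₂ : K) / x ∈ R'),
      (⟨(l₁ : K) / x, h₁⟩ : R') ∈ maximalIdeal R' ∧ (⟨(l₂ : K) / x, h₂⟩ : R') ∈ maximalIdeal R' := by
  classical
  haveI : Fact (2 : ℕ).Prime := ⟨Nat.prime_two⟩
  haveI : CharP R 2 := inferInstance
  haveI : CharP R' 2 := inferInstance
  set f : R := ⟨s ^ 2, hs⟩ with hfdef
  have hfeq : f = g ^ 2 + l₁ * l₂ + c := by linear_combination hf
  have he₁ : D₁ f = l₂ + D₁ c := by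
    rw [hfeq, map_add, map_add, derivation_apply_sq, D₁.leibniz, h11, h12]; simp
  have he₂ : D₂ f = l₁ + D₂ c := by
    rw [hfeq, map_add, map_add, derivation_apply_sq, D₂.leibniz, h21, h22]; simp
  have hD₁c : D₁ c ∈ maximalIdeal R ^ 2 := derivation_apply_mem_pow D₁ _ 2 hc
  have hD₂c : D₂ c ∈ maximalIdeal R ^ 2 := derivation_apply_mem_pow D₂ _ 2 hc
  have hl : ∀ y ∈ ({l₁, l₂, l₃, l₄} : Set R), y ∈ maximalIdeal R := fun y hy => hspan ▸ Ideal.subset_span hy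
  have hl₁ : l₁ ∈ maximalIdeal R := hl _ (by simp)
  have hl₂ : l₂ ∈ maximalIdeal R := hl _ (by simp)
  obtain ⟨γ, hγ⟩ := hsing
  -- `D_j'(f') ∈ 𝔪'`
  have hDF : ∀ D' : Derivation ℤ R' R', D' ⟨s' ^ 2, hs'⟩ ∈ maximalIdeal R' := fun D' => by
    have h := derivation_apply_mem_of_mem_sq D' _ hγ
    rwa [map_sub, derivation_apply_sq, sub_zero] at h
  -- the transform law for both derivations
  have ht₁ := derivation_transform_apply_sq R R' hle x hxR hx0 s s' G hs hs' hG hstep D₁ D₁' hD₁'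
  have ht₂ := derivation_transform_apply_sq R R' hle x hxR hx0 s s' G hs hs' hG hstep D₂ D₂' hD₂'
  -- `D_j c / x ∈ 𝔪'`
  obtain ⟨hc₁R', hc₁m⟩ := div_mem_maximalIdeal_of_mem_sq R R' hle hdom x hdiv hD₁c
  obtain ⟨hc₂R', hc₂m⟩ := div_mem_maximalIdeal_of_mem_sq R R' hle hdom x hdiv hD₂c
  -- `l₂/x = e₁/x − D₁ c/x`, `l₁/x = e₂/x − D₂ c/x`
  have hl₂x : (l₂ : K) / x = ((D₁' ⟨s' ^ 2, hs'⟩ : R') : K) - ((D₁ c : R) : K) / x := by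
    rw [ht₁, ← hfdef, he₁]; push_cast; ring
  have hl₁x : (l₁ : K) / x = ((D₂' ⟨s' ^ 2, hs'⟩ : R') : K) - ((D₂ c : R) : K) / x := by
    rw [ht₂, ← hfdef, he₂]; push_cast; ring
  have h₁ : (l₁ : K) / x ∈ R' := by rw [hl₁x]; exact R'.sub_mem (D₂' _).2 hc₂R'
  have h₂ : (l₂ : K) / x ∈ R' := by rw [hl₂x]; exact R'.sub_mem (D₁' _).2 hc₁R'
  refine ⟨h₁, h₂, ?_, ?_⟩
  · have heq : (⟨(l₁ : K) / x, h₁⟩ : R') = D₂' ⟨s' ^ 2, hs'⟩ - ⟨((D₂ c : R) : K) / x, hc₂R'⟩ :=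
      Subtype.ext (by simpa using hl₁x)
    rw [heq]; exact Ideal.sub_mem _ (hDF D₂') hc₂m
  · have heq : (⟨(l₂ : K) / x, h₂⟩ : R') = D₁' ⟨s' ^ 2, hs'⟩ - ⟨((D₁ c : R) : K) / x, hc₁R'⟩ :=
      Subtype.ext (by simpa using hl₂x)
    rw [heq]; exact Ideal.sub_mem _ (hDF D₁') hc₁m

/-- **(C5) The critical surface is followed — UNCONDITIONAL along a quadratic transform along `O`** (the C9 derivations come from
res-L0-w41-idea-1's LANDED `SteerRankThinness.exists_derivation_smul_quadraticTransformAlong`: `x·D` extends to the transform). Same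
statement as `criticalSurfaceFollowed_of_transform` with the two derivations of `R'` discharged; `hdom` / `hdiv` are the routine
domination and chart facts of the step (`IsQuadraticTransformAlong.dominated`, `eq_locAtCentre_blowupRing`). OURS. [folklore] -/
theorem criticalSurfaceFollowed [CharP K 2] (O : ValuationSubring K) (R R' : Subring K) [IsRegularLocalRing R]
    [IsRegularLocalRing R'] (hQT : IsQuadraticTransformAlong O R R')
    (hdom : ∀ y : R, y ∈ maximalIdeal R → (⟨(y : K), hQT.le y.2⟩ : R') ∈ maximalIdeal R')
    (x : K) (hxR : x ∈ R) (hxm : (⟨x, hxR⟩ : R) ∈ maximalIdeal R) (hx0 : x ≠ 0)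
    (hdiv : ∀ y : R, y ∈ maximalIdeal R → (y : K) / x ∈ R')
    (s s' G : K) (hs : s ^ 2 ∈ R) (hs' : s' ^ 2 ∈ R') (hG : G ∈ R) (hstep : s = x * s' + G)
    (g l₁ l₂ l₃ l₄ c : R) (hf : (⟨s ^ 2, hs⟩ : R) - g ^ 2 = l₁ * l₂ + c) (hc : c ∈ maximalIdeal R ^ 3)
    (hspan : Ideal.span {l₁, l₂, l₃, l₄} = maximalIdeal R)
    (D₁ D₂ : Derivation ℤ R R) (h11 : D₁ l₁ = 1) (h12 : D₁ l₂ = 0) (h21 : D₂ l₁ = 0) (h22 : D₂ l₂ = 1)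
    (hsing : ∃ γ : R', (⟨s' ^ 2, hs'⟩ : R') - γ ^ 2 ∈ maximalIdeal R' ^ 2) :
    ∃ (h₁ : (l₁ : K) / x ∈ R') (h₂ : (l₂ : K) / x ∈ R'),
      (⟨(l₁ : K) / x, h₁⟩ : R') ∈ maximalIdeal R' ∧ (⟨(l₂ : K) / x, h₂⟩ : R') ∈ maximalIdeal R' := by
  obtain ⟨D₁', hD₁'⟩ :=
    SteerRankThinness.exists_derivation_smul_quadraticTransformAlong O R R' hQT ⟨x, hxR⟩ hxm D₁
  obtain ⟨D₂', hD₂'⟩ :=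
    SteerRankThinness.exists_derivation_smul_quadraticTransformAlong O R R' hQT ⟨x, hxR⟩ hxm D₂
  refine criticalSurfaceFollowed_of_transform R R' hQT.le hdom x hxR hx0 hdiv s s' G hs hs' hG hstep g l₁ l₂ l₃ l₄ c
    hf hc hspan D₁ D₂ h11 h12 h21 h22 D₁' D₂' (fun y => ?_) (fun y => ?_) hsing
  · have e : Subring.inclusion hQT.le y = ⟨(y : K), hQT.le y.2⟩ := rfl
    have h := congrArg (fun z : R' => (z : K)) (hD₁' y)
    rw [e] at h
    simpa using h
  · have e : Subring.inclusion hQT.le y = ⟨(y : K), hQT.le y.2⟩ := rfl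
    have h := congrArg (fun z : R' => (z : K)) (hD₂' y)
    rw [e] at h
    simpa using h

end CriticalSurface

end Summit.ResolutionOfSingularities.ResolutionOfSingularities.Theorems.SwitchingDichotomy

end
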